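import Literature.Topology.CoveringSpaces.CoveringNormalClosure
import Literature.Topology.CoveringSpaces.CoveringMonodromyStabilizer
import Literature.Topology.CoveringSpaces.CoveringMapOfComp
import HarnessLib

/-!
# The Galois closure of a finite connected cover: minimality, and the cover as a quotient of it

Topic `Literature/Topology/CoveringSpaces` — sequel of `CoveringNormalClosure.lean` (step (E) of the
topological Galois correspondence; abc-iut cell campaign-L R1, GAP row G-L4t14-R1; classical), over
`CoveringMonodromyStabilizer.lean` (stabilisers of the monodromy action = `p_* π₁`, transitivity;
Hatcher Props. 1.31–1.32) and `CoveringMapOfComp.lean` (Hatcher §1.3 Ex. 16: a map of covers is a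
covering map; an intermediate cover of a normal cover is a quotient cover).

For a covering map `p : E → X` with `E` path connected and `e ∈ p⁻¹{x}`:

* `ker_monodromyPerm_eq_normalCore` — **minimality of the closure**: the kernel of the monodromy
  representation `π₁(X, x) →* Perm(p⁻¹{x})` is the NORMAL CORE of `p_* π₁(E, e)` (the largest
  normal subgroup of `π₁(X, x)` inside `p_* π₁(E, e)`), i.e. the cover `X̃ ⧸ ker` of
  `CoveringNormalClosure.lean` is the smallest normal cover dominating `E`.
* `UniversalCover.isCoveringMap_of_comp_eq_orbitLift`, `….isQuotientCoveringMap_of_comp_eq_orbitLift`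
  — **the cover is a quotient of its closure**: every continuous `f : X̃ ⧸ N → E` over `X`
  (`p ∘ f = p̄`, `N ⊴ π₁(X, x₀)`), in particular the domination map of
  `UniversalCover.exists_map_orbitQuotient_of_le`, is a covering map and, when onto, the quotient
  covering map of the subgroup `{g ∈ π₁(X, x₀) ⧸ N | f ∘ (g • ·) = f}` (Hatcher Ex. 1.3.16 applied
  to the quotient cover `p̄ : X̃ ⧸ N → X` of `NormalSubgroupCovering.lean`).
* `exists_isQuotientCoveringMap_factor` — packaged: every path connected cover of `X` with a finite
  fibre is the QUOTIENT `Y → E ≅ Y ⧸ H` of the total space `Y` of a finite normal cover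
  `q : Y → X` (group `G` finite) by a subgroup `H ≤ G`, compatibly (`p ∘ f = q`).

Proof-only; no definitions, no named facts.

## References
* A. Hatcher, *Algebraic Topology*, CUP 2002, §1.3 Props. 1.31, 1.32, 1.36, 1.39, Exercise 16
  (p. 80). [HatcherAT2002]
-/

noncomputable section

open Set Function MulAction
open _root_.Topology

namespace Literature.Topology.CoveringSpaces

universe u v

/-! ### §1 Minimality: `ker (monodromy) = normal core of p_* π₁(E, e)` -/

section Minimal

variable {E : Type v} {X : Type u} [TopologicalSpace E] [TopologicalSpace X] {p : E → X}

/-- **The kernel of the monodromy representation is the normal core of `p_* π₁(E, e)`** when `E`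
is path connected: `⊆` because the kernel is a normal subgroup fixing `e`, and the stabiliser of
`e` is `p_* π₁(E, e)` (Hatcher Prop. 1.31, `CoverMonodromy.range_mapOfEq_eq_stabilizer`); `⊇`
because the action is transitive on the fibre (Prop. 1.32), so an element all of whose conjugates
fix `e` fixes every `γ • e`.  Hence `X̃ ⧸ ker` (`CoveringNormalClosure.lean`) is the minimal normal
cover dominating `E`; cf. Hatcher Ex. 1.3.18 (normal covers ↔ normal subgroups).
[cite: HatcherAT2002, §1.3 Props. 1.31–1.32, Prop. 1.39] -/
theorem ker_monodromyPerm_eq_normalCore [PathConnectedSpace E] (hp : IsCoveringMap p) {x : X}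
    (e : p ⁻¹' {x}) :
    (hp.monodromyPerm x).ker = (FundamentalGroup.mapOfEq ⟨p, hp.continuous⟩ e.2).range.normalCore := by
  letI := hp.fundamentalGroupMulAction x
  refine le_antisymm ?_ fun γ hγ ↦ ?_
  · -- a normal subgroup inside the stabiliser lies in the normal core
    exact Subgroup.normal_le_normalCore.mpr (ker_monodromyPerm_le_range_mapOfEq hp e)
  · -- every conjugate of `γ` fixes `e`, and the action is transitive: `γ` fixes everything
    rw [CoverMonodromy.range_mapOfEq_eq_stabilizer hp e] at hγ
    refine MonoidHom.mem_ker.mpr (Equiv.ext fun e' ↦ ?_)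
    change γ • e' = e'
    obtain ⟨g, hg⟩ := CoverMonodromy.exists_monodromy_eq hp e e'
    change g • e = e' at hg
    -- `g⁻¹ γ g ∈ Stab(e)`
    have hconj : (g⁻¹ * γ * g) • e = e := by
      have h1 : g⁻¹ * γ * g⁻¹⁻¹ ∈ stabilizer (FundamentalGroup X x) e := hγ g⁻¹
      rw [inv_inv] at h1
      exact h1
    calc γ • e' = (γ * g) • e := by rw [← hg, ← mul_smul]
      _ = (g * (g⁻¹ * γ * g)) • e := by rw [show g * (g⁻¹ * γ * g) = γ * g by group]
      _ = e' := by rw [mul_smul, hconj, hg]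

end Minimal

/-! ### §2 The cover as a quotient of its Galois closure -/

namespace UniversalCover

variable {X : Type u} [TopologicalSpace X] {x₀ : X} (N : Subgroup (FundamentalGroup X x₀))
  [N.Normal] {E : Type v} [TopologicalSpace E] {p : E → X}
  {pbar : orbitRel.Quotient N (UniversalCover X x₀) → X}

/-- **A map from the normal cover `X̃ ⧸ N` to a cover `E` over `X` is a covering map** (Hatcher
Ex. 1.3.16, first half, `IsCoveringMap.of_comp_eq`, over the locally [path] connected base `X`).
[cite: HatcherAT2002, §1.3 Exercise 16 (p. 80)] -/
theorem isCoveringMap_of_comp_eq_orbitLift [PathConnectedSpace X] [StronglyLocallyContractibleSpace X]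
    (hpbar : ∀ a, pbar (Quotient.mk _ a) = proj a) (hp : IsCoveringMap p)
    {f : orbitRel.Quotient N (UniversalCover X x₀) → E} (hf : Continuous f) (hpf : p ∘ f = pbar) :
    IsCoveringMap f :=
  (isCoveringMap_orbitLift N hpbar).of_comp_eq hp hf (fun a ↦ congrFun hpf a)

/-- **A cover dominated by the normal cover `X̃ ⧸ N` is a quotient of it** (Hatcher Ex. 1.3.16,
second half, `IsQuotientCoveringMap.of_comp`): a continuous surjection `f : X̃ ⧸ N → E` over `X`
is the quotient covering map of the subgroup `H ≤ π₁(X, x₀) ⧸ N` of deck transformations of `p̄`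
preserving `f` (given by its membership characterisation, no definition introduced).
[cite: HatcherAT2002, §1.3 Exercise 16 (p. 80)] -/
theorem isQuotientCoveringMap_of_comp_eq_orbitLift [PathConnectedSpace X]
    [StronglyLocallyContractibleSpace X] (hpbar : ∀ a, pbar (Quotient.mk _ a) = proj a)
    (hp : IsCoveringMap p) {f : orbitRel.Quotient N (UniversalCover X x₀) → E} (hf : Continuous f)
    (hpf : p ∘ f = pbar) (hsurj : Surjective f) (H : Subgroup (FundamentalGroup X x₀ ⧸ N))
    (hH : ∀ g : FundamentalGroup X x₀ ⧸ N, g ∈ H ↔ ∀ a, f (g • a) = f a) :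
    IsQuotientCoveringMap f H :=
  haveI : PathConnectedSpace (orbitRel.Quotient N (UniversalCover X x₀)) := inferInstance
  (hpf ▸ isQuotientCoveringMap_orbitLift N hpbar : IsQuotientCoveringMap (p ∘ f) _).of_comp hp hf
    hsurj H hH

end UniversalCover

/-! ### §3 Packaged statement -/

/-- **Every finite connected cover is a quotient of a finite normal cover** (Galois closure): for
`X` path connected and strongly locally contractible and a covering map `p : E → X` with `E` path
connected and a finite fibre `p⁻¹{x₀}`, there are a path connected space `Y` with an action of a
FINITE group `G`, a quotient covering map `q : Y → X` for `G` (a normal cover with group `G`), a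
subgroup `H ≤ G` and a quotient covering map `f : Y → E` for `H` (so `E ≅ Y ⧸ H` over `X`) with
`p ∘ f = q`.  Witness: `Y = X̃ ⧸ N`, `G = π₁(X, x₀) ⧸ N` for `N` the kernel of the monodromy
representation on `p⁻¹{x₀}` (= the normal core of `p_* π₁(E, e₀)`, `ker_monodromyPerm_eq_normalCore`).
[cite: HatcherAT2002, §1.3 Prop. 1.36, Prop. 1.39, Exercise 16] -/
theorem exists_isQuotientCoveringMap_factor {X : Type u} [TopologicalSpace X]
    [PathConnectedSpace X] [StronglyLocallyContractibleSpace X]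
    {E : Type v} [TopologicalSpace E] [PathConnectedSpace E] {p : E → X} (hp : IsCoveringMap p)
    (x₀ : X) [Finite (p ⁻¹' {x₀})] :
    ∃ (Y : Type u) (_ : TopologicalSpace Y) (G : Type u) (_ : Group G) (_ : MulAction G Y)
      (q : Y → X) (H : Subgroup G) (f : Y → E), IsQuotientCoveringMap q G ∧ Finite G ∧
        PathConnectedSpace Y ∧ IsQuotientCoveringMap f H ∧ p ∘ f = q := by
  -- as in `exists_isQuotientCoveringMap_surjective_factor`: a point over `x₀`, `N := ker`
  obtain ⟨e₁⟩ := (inferInstance : PathConnectedSpace E).nonempty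
  let e₀ : p ⁻¹' {x₀} := hp.monodromy ⟦PathConnectedSpace.somePath (p e₁) x₀⟧ ⟨e₁, rfl⟩
  have he₀ : p (e₀ : E) = x₀ := e₀.2
  let N : Subgroup (FundamentalGroup X x₀) := (hp.monodromyPerm x₀).ker
  haveI : N.FiniteIndex := inferInstance
  let pbar : orbitRel.Quotient N (UniversalCover X x₀) → X :=
    Quotient.lift UniversalCover.proj fun a b h ↦ by
      obtain ⟨n, rfl⟩ := MulAction.mem_orbit_iff.mp h
      exact UniversalCover.proj_smul _ _
  have hpbar : ∀ a, pbar (Quotient.mk _ a) = UniversalCover.proj a := fun _ ↦ rfl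
  obtain ⟨f, hpf, -, hsurj⟩ := UniversalCover.exists_map_orbitQuotient_ker_monodromyPerm hp he₀ hpbar
  -- the subgroup of deck transformations of `p̄` preserving `f`
  let H : Subgroup (FundamentalGroup X x₀ ⧸ N) :=
    { carrier := {g | ∀ a, f (g • a) = f a}
      mul_mem' := fun {a b} ha hb c ↦ by rw [mul_smul, ha, hb]
      one_mem' := fun c ↦ by rw [one_smul]
      inv_mem' := fun {a} ha c ↦ by rw [← ha (a⁻¹ • c), smul_inv_smul] }
  exact ⟨orbitRel.Quotient N (UniversalCover X x₀), inferInstance, FundamentalGroup X x₀ ⧸ N,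
    inferInstance, inferInstance, pbar, H, f, UniversalCover.isQuotientCoveringMap_orbitLift N hpbar,
    inferInstance, inferInstance,
    UniversalCover.isQuotientCoveringMap_of_comp_eq_orbitLift N hpbar hp f.continuous hpf hsurj H
      (fun _ ↦ Iff.rfl), hpf⟩

end Literature.Topology.CoveringSpaces

end
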